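import Summits.CriticalPhenomena.PercolationContinuityZ3.Theorems.PercNearOneGluingNoHeavyPcintChordDiagramCount
import HarnessLib

/-!
# CriticalPhenomena/PercolationContinuityZ3 — Theorems/PercNearOneGluingNoHeavyPcintSignedConfigs.lean: SIGNED CONFIGURATIONS (a chord diagram with signed unpaired letters) — the objects of the forest decomposition behind STRUCTURE law C5-L4c

Lane prim-pcint, STRUCTURE rule «numerics ⇒ structure ⇒ conjecture» (prim-pcint-2 GEN 22; law C5-L4 typed in …PcintSubleadingChordLaw,
mechanism proved in …PcintPolygonSubleadingLaw: `polygonSubleadingCoeffLaw ⟺ ∀ m, #defectSet (Fin 2m) = oneDefect m`).  The closed form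
`oneDefect` is proved (sequels) by the FOREST DECOMPOSITION of an arbitrary chord diagram carrying signed letters.  This file sets up the objects.

A (signed) CONFIGURATION on a finite linear order `α` is a pair `c = (π, σ)`: `π : α → α` an involution WITH fixed points allowed (a partial
chord diagram: the 2-cycles are the chords, the fixed points are the LETTERS) and `σ : α → Bool` the signs of the letters (`false` off the letters).
A letter weighs `±1` (`sgn`), a finset weighs the sum of its letters (`wt`), and the SIGN WORD `sw c` lists the signs of the letters in increasing
order.  A one-defect structure `(π, a, b)` of …PcintDefectDiagrams is the configuration "`π` off the 4-block `Q`, the four points of `Q` as letters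
signed `+ + − −` on `{a, π a} / {b, π b}`", and a block of consecutive steps cancels iff it is `π`-closed off `Q` and BALANCED (`closed_switch_or_iff`)
— i.e. iff it is a closed interval of WEIGHT ZERO of the configuration.  Hence the predicates: `FullSAW` (no non-empty closed interval of weight
zero), `PropSAW` (no proper one), `Indec` (indecomposable: no proper non-empty closed initial segment, and at least one chord), and the PREFIXED
conditions `CondB`/`CondC` on closed initial segments (the weights `W` of the proper suffixes of a prefix of earlier items and the weight `wP` of the
whole prefix) that make the first-item recursion of the sequel close.  Everything is transported along order isomorphisms (`Cfg.conj`), so that a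
class of configurations on a part `↥A` counts as the same class on `Fin #A` (`card_gSet_coe`, `card_eSet_coe`).

HONEST FRAMING: elementary finite combinatorics (definitions and transport) written for the proof of `polygonSubleadingCoeffLaw` (all `m`).
No `sorry`; standard axioms.  Written by prim-pcint-2 gen 22 (prover-prim-pcint-2-g22-0), 2026-08-27.
-/

namespace Summit.CriticalPhenomena.PercolationContinuityZ3.Theorems.Pcint.ChordDiag

variable {α β : Type*} [LinearOrder α] [Fintype α] [LinearOrder β] [Fintype β]

/-! ### Configurations, letters, weights, sign word -/

/-- A configuration: a self-map (involution with fixed points = letters) and a sign function. [folklore] -/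
abbrev Cfg (α : Type*) := (α → α) × (α → Bool)

/-- Well-formed configuration: `π` is an involution and the sign is `false` off the letters. [folklore] -/
def IsCfg (c : Cfg α) : Prop := (∀ t, c.1 (c.1 t) = t) ∧ ∀ t, c.1 t ≠ t → c.2 t = false

/-- The weight of a point: `±1` on a letter according to its sign, `0` on a paired point. [folklore] -/
def sgn (c : Cfg α) (t : α) : ℤ := if c.1 t = t then (if c.2 t then 1 else -1) else 0

omit [Fintype α] in
/-- A letter weighs `±1`, never `0`. [folklore] -/
theorem sgn_ne_zero_of_letter {c : Cfg α} {t : α} (h : c.1 t = t) : sgn c t ≠ 0 := by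
  unfold sgn; rw [if_pos h]; split_ifs <;> decide

omit [Fintype α] in
/-- A paired point weighs `0`. [folklore] -/
theorem sgn_of_not_letter {c : Cfg α} {t : α} (h : c.1 t ≠ t) : sgn c t = 0 := by
  unfold sgn; rw [if_neg h]

/-- The weight of a finset: the sum of the weights of its letters. [folklore] -/
def wt (c : Cfg α) (I : Finset α) : ℤ := ∑ t ∈ I, sgn c t

/-- The letters of a configuration. [folklore] -/
def letters (c : Cfg α) : Finset α := Finset.univ.filter fun t => c.1 t = t

/-- Membership in `letters`. [folklore] -/
theorem mem_letters {c : Cfg α} {t : α} : t ∈ letters c ↔ c.1 t = t := by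
  simp [letters]

/-- The SIGN WORD: the signs of the letters listed in increasing order. [folklore] -/
def sw (c : Cfg α) : List Bool := ((letters c).sort (· ≤ ·)).map c.2

/-- The sign word has one entry per letter. [folklore] -/
theorem length_sw (c : Cfg α) : (sw c).length = (letters c).card := by
  simp [sw]

omit [Fintype α] in
/-- A weight of a single letter. [folklore] -/
theorem wt_singleton (c : Cfg α) (t : α) : wt c {t} = sgn c t := by
  simp [wt]

/-! ### Intervals: convex sets (…PcintChordDiagrams), initial segments -/

omit [Fintype α] in
/-- `I` is an initial segment (a lower set). [folklore] -/
def Init (I : Finset α) : Prop := ∀ ⦃x⦄, x ∈ I → ∀ ⦃y⦄, y ≤ x → y ∈ I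

omit [Fintype α] in
/-- An initial segment is convex. [folklore] -/
theorem Init.convex {I : Finset α} (h : Init I) : Convex I := fun _ _ _ hy _ _ hty => h hy hty

/-! ### The classes of configurations -/

/-- No non-empty closed interval of weight zero. [folklore] -/
def FullSAW (c : Cfg α) : Prop := ∀ I : Finset α, I.Nonempty → Convex I → Closed c.1 I → wt c I ≠ 0

/-- No PROPER non-empty closed interval of weight zero. [folklore] -/
def PropSAW (c : Cfg α) : Prop := ∀ I : Finset α, I.Nonempty → I ≠ Finset.univ → Convex I → Closed c.1 I → wt c I ≠ 0

/-- INDECOMPOSABLE: at least one chord, and no proper non-empty closed initial segment. [folklore] -/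
def Indec (c : Cfg α) : Prop := (∃ t, c.1 t ≠ t) ∧ ∀ I : Finset α, I.Nonempty → Init I → Closed c.1 I → I = Finset.univ

/-- Prefix condition (b): no non-empty closed initial segment completes a proper suffix of the prefix (weights `W`) to weight zero. [folklore] -/
def CondB (c : Cfg α) (W : List ℤ) : Prop :=
  ∀ I : Finset α, I.Nonempty → Init I → Closed c.1 I → ∀ w ∈ W, w + wt c I ≠ 0

/-- Prefix condition (c): no non-empty closed initial segment completes the whole prefix (weight `wP`) to weight zero — except, at the top
(`top = true`), the whole word. [folklore] -/
def CondC (c : Cfg α) (top : Bool) (wP : Option ℤ) : Prop :=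
  ∀ w₀, wP = some w₀ → ∀ I : Finset α, I.Nonempty → Init I → Closed c.1 I → (top = true ∧ I = Finset.univ) ∨ w₀ + wt c I ≠ 0

/-- Condition (a): at the top with empty prefix only PROPER intervals are constrained, otherwise all. [folklore] -/
def CondA (c : Cfg α) (top : Bool) (wP : Option ℤ) : Prop :=
  (top = true ∧ wP = none → PropSAW c) ∧ (¬(top = true ∧ wP = none) → FullSAW c)

/-- The PREFIXED class `G(top, W, wP, S)`: well-formed, sign word `S`, conditions (a), (b), (c). [folklore] -/
def IsGCfg (top : Bool) (W : List ℤ) (wP : Option ℤ) (S : List Bool) (c : Cfg α) : Prop :=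
  IsCfg c ∧ sw c = S ∧ CondA c top wP ∧ CondB c W ∧ CondC c top wP

/-- The ARCH class `E(S)`: well-formed, sign word `S`, indecomposable, no proper closed interval of weight zero. [folklore] -/
def IsECfg (S : List Bool) (c : Cfg α) : Prop := IsCfg c ∧ sw c = S ∧ Indec c ∧ PropSAW c

open Classical in
/-- The finite set `G(top, W, wP, S)` of configurations on `α`. [folklore] -/
noncomputable def gSet (top : Bool) (W : List ℤ) (wP : Option ℤ) (S : List Bool) (α : Type*) [LinearOrder α] [Fintype α] :
    Finset (Cfg α) :=
  Finset.univ.filter fun c => IsGCfg top W wP S c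

open Classical in
/-- The finite set `E(S)` of arch configurations on `α`. [folklore] -/
noncomputable def eSet (S : List Bool) (α : Type*) [LinearOrder α] [Fintype α] : Finset (Cfg α) :=
  Finset.univ.filter fun c => IsECfg S c

/-- Membership in `gSet`. [folklore] -/
theorem mem_gSet {top : Bool} {W : List ℤ} {wP : Option ℤ} {S : List Bool} {c : Cfg α} :
    c ∈ gSet top W wP S α ↔ IsGCfg top W wP S c := by
  simp [gSet]

/-- Membership in `eSet`. [folklore] -/
theorem mem_eSet {S : List Bool} {c : Cfg α} : c ∈ eSet S α ↔ IsECfg S c := by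
  simp [eSet]

/-- The counting function `G(top, W, wP, S)(N)` (configurations on `N` points). [folklore] -/
noncomputable def gCount (top : Bool) (W : List ℤ) (wP : Option ℤ) (S : List Bool) (N : ℕ) : ℕ := (gSet top W wP S (Fin N)).card

/-- The counting function `E(S)(N)` (arch configurations on `N` points). [folklore] -/
noncomputable def eCount (S : List Bool) (N : ℕ) : ℕ := (eSet S (Fin N)).card

/-! ### Transport along order isomorphisms -/

/-- Conjugation of a configuration by an order isomorphism. [folklore] -/
def Cfg.conj (e : α ≃o β) (c : Cfg α) : Cfg β := (fun y => e (c.1 (e.symm y)), fun y => c.2 (e.symm y))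

/-- Pull-back of a finset along an order isomorphism. [folklore] -/
def preO (e : α ≃o β) (I : Finset β) : Finset α := I.map e.symm.toEquiv.toEmbedding

omit [Fintype α] [Fintype β] in
/-- Membership in the pull-back. [folklore] -/
theorem mem_preO (e : α ≃o β) {I : Finset β} {a : α} : a ∈ preO e I ↔ e a ∈ I := by
  unfold preO
  rw [Finset.mem_map_equiv]
  simp

omit [Fintype α] [Fintype β] in
/-- Pull-back of a convex set is convex. [folklore] -/
theorem Convex.preO (e : α ≃o β) {I : Finset β} (h : Convex I) : Convex (preO e I) := fun _ hx _ hy _ hxt hty =>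
  (mem_preO e).2 (h ((mem_preO e).1 hx) ((mem_preO e).1 hy) (e.monotone hxt) (e.monotone hty))

omit [Fintype α] [Fintype β] in
/-- Pull-back of an initial segment is an initial segment. [folklore] -/
theorem Init.preO (e : α ≃o β) {I : Finset β} (h : Init I) : Init (preO e I) := fun _ hx _ hyx =>
  (mem_preO e).2 (h ((mem_preO e).1 hx) (e.monotone hyx))

omit [Fintype α] [Fintype β] in
/-- Pull-back of a closed set is closed for the conjugate's original. [folklore] -/
theorem Closed.preO (e : α ≃o β) {c : Cfg α} {I : Finset β} (h : Closed (Cfg.conj e c).1 I) : Closed c.1 (preO e I) := by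
  intro t ht
  rw [mem_preO] at ht ⊢
  have := h ht
  simpa [Cfg.conj] using this

omit [Fintype α] [Fintype β] in
/-- Push-forward: the image of `preO e I` is `I`; non-emptiness and `univ` are preserved. [folklore] -/
theorem preO_nonempty (e : α ≃o β) {I : Finset β} (h : I.Nonempty) : (preO e I).Nonempty := by
  obtain ⟨y, hy⟩ := h
  exact ⟨e.symm y, (mem_preO e).2 (by simpa using hy)⟩

/-- `preO e I = univ` iff `I = univ`. [folklore] -/
theorem preO_eq_univ (e : α ≃o β) {I : Finset β} : preO e I = Finset.univ ↔ I = Finset.univ := by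
  constructor
  · intro h
    refine Finset.eq_univ_iff_forall.2 fun y => ?_
    have : e.symm y ∈ preO e I := h ▸ Finset.mem_univ _
    simpa [mem_preO] using this
  · intro h
    exact Finset.eq_univ_iff_forall.2 fun a => (mem_preO e).2 (h ▸ Finset.mem_univ _)

omit [Fintype α] [Fintype β] in
/-- The conjugate's map on a point. [folklore] -/
theorem conj_fst (e : α ≃o β) (c : Cfg α) (y : β) : (Cfg.conj e c).1 y = e (c.1 (e.symm y)) := rfl

omit [Fintype α] [Fintype β] in
/-- Letters of the conjugate. [folklore] -/
theorem conj_letter_iff (e : α ≃o β) (c : Cfg α) (y : β) : (Cfg.conj e c).1 y = y ↔ c.1 (e.symm y) = e.symm y := by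
  rw [conj_fst]
  constructor
  · intro h; simpa using congrArg e.symm h
  · intro h; rw [h]; simp

omit [Fintype α] [Fintype β] in
/-- Weights of points are transported. [folklore] -/
theorem sgn_conj (e : α ≃o β) (c : Cfg α) (y : β) : sgn (Cfg.conj e c) y = sgn c (e.symm y) := by
  unfold sgn
  by_cases h : c.1 (e.symm y) = e.symm y
  · rw [if_pos ((conj_letter_iff e c y).2 h), if_pos h]; rfl
  · rw [if_neg (fun h' => h ((conj_letter_iff e c y).1 h')), if_neg h]

omit [Fintype α] [Fintype β] in
/-- Weights of finsets are transported. [folklore] -/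
theorem wt_conj (e : α ≃o β) (c : Cfg α) (I : Finset β) : wt (Cfg.conj e c) I = wt c (preO e I) := by
  unfold wt preO
  rw [Finset.sum_map]
  refine Finset.sum_congr rfl fun y _ => ?_
  rw [sgn_conj]
  rfl

omit [Fintype α] [Fintype β] in
/-- Well-formedness is transported. [folklore] -/
theorem IsCfg.conj (e : α ≃o β) {c : Cfg α} (h : IsCfg c) : IsCfg (Cfg.conj e c) := by
  refine ⟨fun y => ?_, fun y hy => ?_⟩
  · simp [Cfg.conj, h.1]
  · have : c.1 (e.symm y) ≠ e.symm y := fun h' => hy ((conj_letter_iff e c y).2 h')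
    exact h.2 _ this

/-- Letters are transported. [folklore] -/
theorem letters_conj (e : α ≃o β) (c : Cfg α) : letters (Cfg.conj e c) = (letters c).map e.toEquiv.toEmbedding := by
  ext y
  rw [mem_letters, Finset.mem_map_equiv, mem_letters, conj_letter_iff]
  rfl

/-- The sign word is invariant. [folklore] -/
theorem sw_conj (e : α ≃o β) (c : Cfg α) : sw (Cfg.conj e c) = sw c := by
  unfold sw
  rw [letters_conj]
  have hsort : ((letters c).map e.toEquiv.toEmbedding).sort (· ≤ ·) = ((letters c).sort (· ≤ ·)).map e := by
    rw [← Finset.map_sort (r := (· ≤ ·)) (r' := (· ≤ ·)) (f := e.toEquiv.toEmbedding) (s := letters c)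
      (fun a _ b _ => by simp)]
    rfl
  rw [hsort, List.map_map]
  congr 1
  funext a
  simp [Cfg.conj]

omit [Fintype α] [Fintype β] in
/-- `FullSAW` is transported. [folklore] -/
theorem FullSAW.conj (e : α ≃o β) {c : Cfg α} (h : FullSAW c) : FullSAW (Cfg.conj e c) := fun I hne hc hcl => by
  rw [wt_conj]; exact h _ (preO_nonempty e hne) (hc.preO e) (Closed.preO e hcl)

/-- `PropSAW` is transported. [folklore] -/
theorem PropSAW.conj (e : α ≃o β) {c : Cfg α} (h : PropSAW c) : PropSAW (Cfg.conj e c) := fun I hne hnu hc hcl => by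
  rw [wt_conj]; exact h _ (preO_nonempty e hne) (fun h' => hnu ((preO_eq_univ e).1 h')) (hc.preO e) (Closed.preO e hcl)

/-- `Indec` is transported. [folklore] -/
theorem Indec.conj (e : α ≃o β) {c : Cfg α} (h : Indec c) : Indec (Cfg.conj e c) := by
  obtain ⟨⟨t, ht⟩, h⟩ := h
  refine ⟨⟨e t, fun h' => ht (by simpa using (conj_letter_iff e c (e t)).1 h')⟩, fun I hne hi hcl => ?_⟩
  exact (preO_eq_univ e).1 (h _ (preO_nonempty e hne) (hi.preO e) (Closed.preO e hcl))

omit [Fintype α] [Fintype β] in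
/-- `CondB` is transported. [folklore] -/
theorem CondB.conj (e : α ≃o β) {c : Cfg α} {W : List ℤ} (h : CondB c W) : CondB (Cfg.conj e c) W := fun I hne hi hcl w hw => by
  rw [wt_conj]; exact h _ (preO_nonempty e hne) (hi.preO e) (Closed.preO e hcl) w hw

/-- `CondC` is transported. [folklore] -/
theorem CondC.conj (e : α ≃o β) {c : Cfg α} {top : Bool} {wP : Option ℤ} (h : CondC c top wP) :
    CondC (Cfg.conj e c) top wP := fun w₀ hw I hne hi hcl => by
  rw [wt_conj]
  rcases h w₀ hw _ (preO_nonempty e hne) (hi.preO e) (Closed.preO e hcl) with h1 | h2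
  · exact Or.inl ⟨h1.1, (preO_eq_univ e).1 h1.2⟩
  · exact Or.inr h2

/-- The prefixed class is transported. [folklore] -/
theorem IsGCfg.conj (e : α ≃o β) {top : Bool} {W : List ℤ} {wP : Option ℤ} {S : List Bool} {c : Cfg α}
    (h : IsGCfg top W wP S c) : IsGCfg top W wP S (Cfg.conj e c) :=
  ⟨h.1.conj e, (sw_conj e c).trans h.2.1, ⟨fun hm => (h.2.2.1.1 hm).conj e, fun hm => (h.2.2.1.2 hm).conj e⟩,
    h.2.2.2.1.conj e, h.2.2.2.2.conj e⟩

/-- The arch class is transported. [folklore] -/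
theorem IsECfg.conj (e : α ≃o β) {S : List Bool} {c : Cfg α} (h : IsECfg S c) : IsECfg S (Cfg.conj e c) :=
  ⟨h.1.conj e, (sw_conj e c).trans h.2.1, h.2.2.1.conj e, h.2.2.2.conj e⟩

omit [Fintype α] [Fintype β] in
/-- Conjugating back and forth. [folklore] -/
theorem conj_symm_conj (e : α ≃o β) (c : Cfg α) : Cfg.conj e.symm (Cfg.conj e c) = c := by
  ext y <;> simp [Cfg.conj]

/-- **`#G` is an order-isomorphism invariant.** [folklore] -/
theorem card_gSet_congr (e : α ≃o β) (top : Bool) (W : List ℤ) (wP : Option ℤ) (S : List Bool) :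
    (gSet top W wP S α).card = (gSet top W wP S β).card := by
  refine Finset.card_nbij' (Cfg.conj e) (Cfg.conj e.symm) ?_ ?_ ?_ ?_
  · intro c hc; rw [Finset.mem_coe, mem_gSet] at hc ⊢; exact hc.conj e
  · intro c hc; rw [Finset.mem_coe, mem_gSet] at hc ⊢; exact hc.conj e.symm
  · intro c _; exact conj_symm_conj e c
  · intro c _
    have := conj_symm_conj e.symm c
    simpa using this

/-- **`#E` is an order-isomorphism invariant.** [folklore] -/
theorem card_eSet_congr (e : α ≃o β) (S : List Bool) : (eSet S α).card = (eSet S β).card := by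
  refine Finset.card_nbij' (Cfg.conj e) (Cfg.conj e.symm) ?_ ?_ ?_ ?_
  · intro c hc; rw [Finset.mem_coe, mem_eSet] at hc ⊢; exact hc.conj e
  · intro c hc; rw [Finset.mem_coe, mem_eSet] at hc ⊢; exact hc.conj e.symm
  · intro c _; exact conj_symm_conj e c
  · intro c _
    have := conj_symm_conj e.symm c
    simpa using this

omit [Fintype α] in
/-- A part counts as `Fin` of its size (prefixed class). [folklore] -/
theorem card_gSet_coe (A : Finset α) (top : Bool) (W : List ℤ) (wP : Option ℤ) (S : List Bool) :
    (gSet top W wP S ↥A).card = gCount top W wP S A.card :=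
  (card_gSet_congr (A.orderIsoOfFin rfl) top W wP S).symm

omit [Fintype α] in
/-- A part counts as `Fin` of its size (arch class). [folklore] -/
theorem card_eSet_coe (A : Finset α) (S : List Bool) : (eSet S ↥A).card = eCount S A.card :=
  (card_eSet_congr (A.orderIsoOfFin rfl) S).symm

end Summit.CriticalPhenomena.PercolationContinuityZ3.Theorems.Pcint.ChordDiag
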